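import Literature.Dynamics.Tilings.WangTiles
import Literature.Computability.Complexity.CNF
import HarnessLib

/-!
# The torus tautologies of a Wang tile set: "`T` tiles the `n × n` torus" as a CNF

For a tile set `T` with tiles `Fin t` (colours in any type with decidable equality) and
`n : ℕ`, the CNF `torusCNF T n` over variables `ℕ` says that the discrete torus `(ℤ/n)²` is
tiled by `T` (`Literature.Dynamics.Tilings.WangTileSet.TilesTorus`): the standard direct
("one-hot") propositional encoding of the constraint-satisfaction problem, as inlined by `let`
in every item of route `PneNP/AperiodicTorus` (the "torus tautologies" `τ(T, n)` of aperiodic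
tile sets).

* Variables: `torusVar n i j s = (i·n + j)·t + s` — "cell `(i, j)` carries tile `s`"
  (`i j : Fin n`, `s : Fin t`; injective, `torusVar_injective`).
* Clauses of `torusCNF T n`, in this order: for every cell the at-least-one clause
  `⋁ₛ x_(i,j,s)`; for every cell and every pair `s < s'` the at-most-one clause
  `¬x_(i,j,s) ∨ ¬x_(i,j,s')`; for every cell and every pair `(s, s')` with `east s ≠ west s'`
  the horizontal clause `¬x_(i,j,s) ∨ ¬x_(i,(j+1) mod n,s')`; for every cell and every pair with
  `south s ≠ north s'` the vertical clause `¬x_(i,j,s) ∨ ¬x_((i+1) mod n,j,s')` (wrap-around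
  included, so `n = 1, 2` are covered by the same formula).
* `torusForm T n := ¬ (torusCNF T n)` read as a propositional formula
  (`PropForm.neg (PropForm.ofCNF _)`).
* `torusCNF_satisfiable_iff : (torusCNF T n).Satisfiable ↔ T.TilesTorus n` (encoding
  correctness) and `isTautology_torusForm_iff : (torusForm T n).IsTautology ↔ ¬ T.TilesTorus n`;
  `mem_torusCNF_iff` (the four clause families), `torusCNF_isWidthLE` (width `≤ max t 2`).
* `torusCNF_ofNESW` : on a colour table `τ : Fin t → ℕ × ℕ × ℕ × ℕ` the definition unfolds by
  `rfl` to the term inlined in the route's items, so that they can be re-signed to the named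
  form with identical meaning.

The encoding itself is folklore (direct encoding of a finite-domain CSP; bounded tiling
problems as the generic NP-complete problems go back to Levin 1973 and Lewis 1978); no
published source is followed verbatim, hence the `[folklore]` tags. Tilings and tori:
[Jeandel–Vanier 2020, §1.1–1.2]; CNFs, satisfiability, tautologies:
`Literature/Computability/Complexity/CNF.lean` [Cook 1971, §1; Arora–Barak 2009, Def. 2.9].

## References

* E. Jeandel, P. Vanier, *The undecidability of the Domino Problem*, LNM 2273 (2020), §1.1–1.2.
* S. A. Cook, *The complexity of theorem-proving procedures*, STOC 1971, §1.
* S. Arora, B. Barak, *Computational Complexity: A Modern Approach*, CUP 2009, Def. 2.9.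
-/

namespace Literature.Dynamics.Tilings

namespace WangTileSet

open Literature.Computability.Complexity

universe v

variable {C : Type v} [DecidableEq C] {t : ℕ}

/-! ### The encoding -/

/-- The propositional variable "cell `(i, j)` of the `n × n` torus carries tile `s`", numbered
`(i·n + j)·t + s`. [folklore] -/
def torusVar (t n : ℕ) (i j : Fin n) (s : Fin t) : ℕ :=
  (i.1 * n + j.1) * t + s.1

/-- **The torus CNF** `τ(T, n)`: "the tile set `T` tiles the `n × n` torus", in the direct
encoding — per cell an at-least-one clause and the at-most-one 2-clauses, and for every cell
and every horizontally (resp. vertically) mismatching ordered pair of tiles the 2-clause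
forbidding it on that cell and its east (resp. south) neighbour, indices mod `n`. Written with
the `let`s inlined in route PneNP/AperiodicTorus (`torusCNF_ofNESW`). [folklore] -/
def torusCNF (T : WangTileSet (Fin t) C) (n : ℕ) : CNF ℕ :=
  let v : Fin n → Fin n → Fin t → ℕ := fun i j s => (i.1 * n + j.1) * t + s.1
  let nx : Fin n → Fin n := fun i => ⟨(i.1 + 1) % n, Nat.mod_lt _ i.pos⟩
  let cells : List (Fin n × Fin n) :=
    (List.finRange n).flatMap fun i => (List.finRange n).map fun j => (i, j)
  let prs : List (Fin t × Fin t) :=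
    (List.finRange t).flatMap fun s => (List.finRange t).map fun s' => (s, s')
  (cells.map fun c => (List.finRange t).map fun s => (v c.1 c.2 s, true)) ++
  (cells.flatMap fun c => (prs.filter fun q => decide (q.1 < q.2)).map fun q =>
    [(v c.1 c.2 q.1, false), (v c.1 c.2 q.2, false)]) ++
  (cells.flatMap fun c => (prs.filter fun q => decide (T.east q.1 ≠ T.west q.2)).map fun q =>
    [(v c.1 c.2 q.1, false), (v c.1 (nx c.2) q.2, false)]) ++
  (cells.flatMap fun c => (prs.filter fun q => decide (T.south q.1 ≠ T.north q.2)).map fun q =>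
    [(v c.1 c.2 q.1, false), (v (nx c.1) c.2 q.2, false)])

/-- **The torus tautology** `¬ τ(T, n)`: the negation of the torus CNF, as a propositional
formula; a tautology iff `T` does not tile the `n × n` torus (`isTautology_torusForm_iff`).
[folklore] -/
def torusForm (T : WangTileSet (Fin t) C) (n : ℕ) : PropForm ℕ :=
  PropForm.neg (PropForm.ofCNF (T.torusCNF n))

/-- On a colour table `τ : Fin t → ℕ⁴` the torus CNF is, by `rfl`, the term inlined in the items
of route PneNP/AperiodicTorus. [folklore] -/
theorem torusCNF_ofNESW (τ : Fin t → ℕ × ℕ × ℕ × ℕ) (n : ℕ) :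
    (ofNESW τ).torusCNF n =
      (let v : Fin n → Fin n → Fin t → ℕ := fun i j s => (i.1 * n + j.1) * t + s.1
      let nx : Fin n → Fin n := fun i => ⟨(i.1 + 1) % n, Nat.mod_lt _ i.pos⟩
      let cells : List (Fin n × Fin n) :=
        (List.finRange n).flatMap fun i => (List.finRange n).map fun j => (i, j)
      let prs : List (Fin t × Fin t) :=
        (List.finRange t).flatMap fun s => (List.finRange t).map fun s' => (s, s')
      (cells.map fun c => (List.finRange t).map fun s => (v c.1 c.2 s, true)) ++
      (cells.flatMap fun c => (prs.filter fun q => decide (q.1 < q.2)).map fun q =>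
        [(v c.1 c.2 q.1, false), (v c.1 c.2 q.2, false)]) ++
      (cells.flatMap fun c => (prs.filter fun q => decide ((τ q.1).2.1 ≠ (τ q.2).2.2.2)).map
        fun q => [(v c.1 c.2 q.1, false), (v c.1 (nx c.2) q.2, false)]) ++
      (cells.flatMap fun c => (prs.filter fun q => decide ((τ q.1).2.2.1 ≠ (τ q.2).1)).map
        fun q => [(v c.1 c.2 q.1, false), (v (nx c.1) c.2 q.2, false)])) :=
  rfl

/-! ### Structure of the encoding -/

/-- The variable numbering `(i, j, s) ↦ (i·n + j)·t + s` is injective. [folklore] -/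
theorem torusVar_injective {n : ℕ} {i j i' j' : Fin n} {s s' : Fin t}
    (h : torusVar t n i j s = torusVar t n i' j' s') : i = i' ∧ j = j' ∧ s = s' := by
  unfold torusVar at h
  -- mixed radix: first the digit `s`, then `j`, then `i`
  have key : ∀ {a a' r r' m : ℕ}, r < m → r' < m → a * m + r = a' * m + r' → a = a' ∧ r = r' := by
    intro a a' r r' m hr hr' he
    have hm : 0 < m := lt_of_le_of_lt (Nat.zero_le _) hr
    have h1 : (r + a * m) / m = (r' + a' * m) / m := by rw [Nat.add_comm, he, Nat.add_comm]
    rw [Nat.add_mul_div_right _ _ hm, Nat.add_mul_div_right _ _ hm, Nat.div_eq_of_lt hr,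
      Nat.div_eq_of_lt hr'] at h1
    have h2 : (r + a * m) % m = (r' + a' * m) % m := by rw [Nat.add_comm, he, Nat.add_comm]
    rw [Nat.add_mul_mod_self_right, Nat.add_mul_mod_self_right, Nat.mod_eq_of_lt hr,
      Nat.mod_eq_of_lt hr'] at h2
    exact ⟨by simpa using h1, h2⟩
  obtain ⟨hij, hs⟩ := key s.2 s'.2 h
  obtain ⟨hi, hj⟩ := key j.2 j'.2 hij
  exact ⟨Fin.ext hi, Fin.ext hj, Fin.ext hs⟩

/-- **The four clause families.** A clause belongs to `torusCNF T n` iff it is an at-least-one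
clause of a cell, an at-most-one clause of a cell and a pair `s < s'`, a horizontal mismatch
clause, or a vertical mismatch clause. [folklore] -/
theorem mem_torusCNF_iff (T : WangTileSet (Fin t) C) (n : ℕ) (c : Clause ℕ) :
    c ∈ T.torusCNF n ↔
      (∃ i j : Fin n, c = (List.finRange t).map fun s => (torusVar t n i j s, true)) ∨
      (∃ (i j : Fin n) (s s' : Fin t), s < s' ∧
        c = [(torusVar t n i j s, false), (torusVar t n i j s', false)]) ∨
      (∃ (i j : Fin n) (s s' : Fin t), T.east s ≠ T.west s' ∧
        c = [(torusVar t n i j s, false),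
          (torusVar t n i ⟨(j.1 + 1) % n, Nat.mod_lt _ j.pos⟩ s', false)]) ∨
      (∃ (i j : Fin n) (s s' : Fin t), T.south s ≠ T.north s' ∧
        c = [(torusVar t n i j s, false),
          (torusVar t n ⟨(i.1 + 1) % n, Nat.mod_lt _ i.pos⟩ j s', false)]) := by
  simp only [torusCNF, torusVar, List.mem_append, List.mem_map, List.mem_flatMap,
    List.mem_filter, List.mem_finRange, true_and, decide_eq_true_eq, Prod.exists,
    Prod.mk.injEq, or_assoc]
  constructor
  · rintro (⟨i, j, -, rfl⟩ | ⟨i, j, -, s, s', ⟨-, hlt⟩, rfl⟩ | ⟨i, j, -, s, s', ⟨-, hne⟩, rfl⟩ |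
        ⟨i, j, -, s, s', ⟨-, hne⟩, rfl⟩)
    · exact Or.inl ⟨i, j, rfl⟩
    · exact Or.inr (Or.inl ⟨i, j, s, s', hlt, rfl⟩)
    · exact Or.inr (Or.inr (Or.inl ⟨i, j, s, s', hne, rfl⟩))
    · exact Or.inr (Or.inr (Or.inr ⟨i, j, s, s', hne, rfl⟩))
  · rintro (⟨i, j, rfl⟩ | ⟨i, j, s, s', hlt, rfl⟩ | ⟨i, j, s, s', hne, rfl⟩ | ⟨i, j, s, s', hne, rfl⟩)
    · exact Or.inl ⟨i, j, ⟨i, j, rfl, rfl⟩, rfl⟩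
    · exact Or.inr (Or.inl ⟨i, j, ⟨i, j, rfl, rfl⟩, s, s', ⟨⟨s, s', rfl, rfl⟩, hlt⟩, rfl⟩)
    · exact Or.inr (Or.inr (Or.inl ⟨i, j, ⟨i, j, rfl, rfl⟩, s, s', ⟨⟨s, s', rfl, rfl⟩, hne⟩, rfl⟩))
    · exact Or.inr (Or.inr (Or.inr ⟨i, j, ⟨i, j, rfl, rfl⟩, s, s', ⟨⟨s, s', rfl, rfl⟩, hne⟩, rfl⟩))

/-- The torus CNF has width `≤ max t 2` (at-least-one clauses have `t` literals, all others
two). [folklore] -/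
theorem torusCNF_isWidthLE (T : WangTileSet (Fin t) C) (n : ℕ) :
    (T.torusCNF n).IsWidthLE (max t 2) := by
  intro c hc
  rcases (mem_torusCNF_iff T n c).1 hc with
    ⟨i, j, rfl⟩ | ⟨i, j, s, s', -, rfl⟩ | ⟨i, j, s, s', -, rfl⟩ | ⟨i, j, s, s', -, rfl⟩
  · simp
  all_goals simp

/-! ### Semantics: satisfying assignments are torus tilings -/

/-- A 2-clause of two negative literals is true iff not both variables are true. [folklore] -/
theorem eval_pair_neg (σ : ℕ → Bool) (x y : ℕ) :
    Clause.eval σ [(x, false), (y, false)] = true ↔ ¬ (σ x = true ∧ σ y = true) := by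
  cases hx : σ x <;> cases hy : σ y <;> simp [Clause.eval, Literal.eval, hx, hy]

/-- The at-least-one clause of cell `(i, j)` is true iff some variable `x_(i,j,s)` is true.
[folklore] -/
theorem eval_atLeastOne {n : ℕ} (σ : ℕ → Bool) (i j : Fin n) :
    Clause.eval σ ((List.finRange t).map fun s => (torusVar t n i j s, true)) = true ↔
      ∃ s : Fin t, σ (torusVar t n i j s) = true := by
  simp [Clause.eval, Literal.eval, List.any_eq_true]

/-- **Soundness of the encoding**: a satisfying assignment of `torusCNF T n` yields a tiling of
the `n × n` torus (pick in each cell a tile whose variable is true; the mismatch clauses force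
matching colours). [folklore] -/
theorem tilesTorus_of_satisfiable (T : WangTileSet (Fin t) C) {n : ℕ}
    (h : (T.torusCNF n).Satisfiable) : T.TilesTorus n := by
  obtain ⟨σ, hσ⟩ := h
  rw [CNF.eval_eq_true_iff] at hσ
  -- every cell carries some tile
  have hcell : ∀ i j : Fin n, ∃ s : Fin t, σ (torusVar t n i j s) = true := fun i j =>
    (eval_atLeastOne σ i j).1 (hσ _ ((mem_torusCNF_iff T n _).2 (Or.inl ⟨i, j, rfl⟩)))
  choose f hf using hcell
  refine ⟨f, fun i j => ⟨?_, ?_⟩⟩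
  · by_contra hne
    have hc := hσ _ ((mem_torusCNF_iff T n _).2 (Or.inr (Or.inr (Or.inl
      ⟨i, j, f i j, f i ⟨(j.1 + 1) % n, Nat.mod_lt _ j.pos⟩, hne, rfl⟩))))
    exact (eval_pair_neg σ _ _).1 hc ⟨hf i j, hf i _⟩
  · by_contra hne
    have hc := hσ _ ((mem_torusCNF_iff T n _).2 (Or.inr (Or.inr (Or.inr
      ⟨i, j, f i j, f ⟨(i.1 + 1) % n, Nat.mod_lt _ i.pos⟩ j, hne, rfl⟩))))
    exact (eval_pair_neg σ _ _).1 hc ⟨hf i j, hf _ j⟩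

/-- **Completeness of the encoding**: a tiling `f` of the `n × n` torus satisfies
`torusCNF T n` under the assignment "`x_(i,j,s)` is true iff `f i j = s`". [folklore] -/
theorem satisfiable_of_tilesTorus (T : WangTileSet (Fin t) C) {n : ℕ} (h : T.TilesTorus n) :
    (T.torusCNF n).Satisfiable := by
  classical
  obtain ⟨f, hf⟩ := h
  -- the characteristic assignment of the graph of `f`
  let σ : ℕ → Bool := fun m => decide (∃ i j : Fin n, torusVar t n i j (f i j) = m)
  have hσ : ∀ (i j : Fin n) (s : Fin t), σ (torusVar t n i j s) = true ↔ f i j = s := by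
    intro i j s
    simp only [σ, decide_eq_true_eq]
    constructor
    · rintro ⟨i', j', he⟩
      obtain ⟨rfl, rfl, hs⟩ := torusVar_injective he
      exact hs
    · rintro rfl
      exact ⟨i, j, rfl⟩
  refine ⟨σ, (CNF.eval_eq_true_iff _ _).2 fun c hc => ?_⟩
  rcases (mem_torusCNF_iff T n c).1 hc with
    ⟨i, j, rfl⟩ | ⟨i, j, s, s', hlt, rfl⟩ | ⟨i, j, s, s', hne, rfl⟩ | ⟨i, j, s, s', hne, rfl⟩
  · exact (eval_atLeastOne σ i j).2 ⟨f i j, (hσ i j _).2 rfl⟩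
  · refine (eval_pair_neg σ _ _).2 fun ⟨h1, h2⟩ => ?_
    rw [hσ] at h1 h2
    obtain rfl : s = s' := h1.symm.trans h2
    exact lt_irrefl _ hlt
  · refine (eval_pair_neg σ _ _).2 fun ⟨h1, h2⟩ => ?_
    rw [hσ] at h1 h2
    exact hne (by rw [← h1, ← h2]; exact (hf i j).1)
  · refine (eval_pair_neg σ _ _).2 fun ⟨h1, h2⟩ => ?_
    rw [hσ] at h1 h2
    exact hne (by rw [← h1, ← h2]; exact (hf i j).2)

/-- **Encoding correctness**: `torusCNF T n` is satisfiable iff `T` tiles the `n × n` torus.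
[folklore] -/
theorem torusCNF_satisfiable_iff (T : WangTileSet (Fin t) C) (n : ℕ) :
    (T.torusCNF n).Satisfiable ↔ T.TilesTorus n :=
  ⟨T.tilesTorus_of_satisfiable, T.satisfiable_of_tilesTorus⟩

/-- **The torus tautology**: `torusForm T n` is a tautology iff `T` does not tile the `n × n`
torus. [folklore] -/
theorem isTautology_torusForm_iff (T : WangTileSet (Fin t) C) (n : ℕ) :
    (T.torusForm n).IsTautology ↔ ¬ T.TilesTorus n := by
  rw [← torusCNF_satisfiable_iff]
  simp only [torusForm, PropForm.IsTautology, PropForm.eval, PropForm.eval_ofCNF,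
    CNF.Satisfiable, Bool.not_eq_true', not_exists, Bool.not_eq_true]

/-- The torus tautologies of an aperiodic tile set are tautologies for every `n ≥ 1`.
[folklore] -/
theorem IsAperiodic.isTautology_torusForm {T : WangTileSet (Fin t) C} (h : T.IsAperiodic)
    {n : ℕ} (hn : 1 ≤ n) : (T.torusForm n).IsTautology :=
  (T.isTautology_torusForm_iff n).2 (h.not_tilesTorus hn)

/-- The junk case `n = 0`: the empty torus is tiled, so `torusCNF T 0` (the empty CNF) is
satisfiable and `torusForm T 0` is not a tautology. [folklore] -/
theorem not_isTautology_torusForm_zero (T : WangTileSet (Fin t) C) :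
    ¬ (T.torusForm 0).IsTautology := by
  rw [isTautology_torusForm_iff, not_not]
  exact T.tilesTorus_zero

end WangTileSet

end Literature.Dynamics.Tilings
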